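import Literature.Geometry.Symplectic.ZeroCircleAdaptedChart
import Literature.Geometry.Symplectic.ZeroCircleGradientFamily
import Literature.Geometry.Symplectic.NearSymplecticPullbackTransport
import Literature.Geometry.Symplectic.TubeLogCutoff
import Literature.Geometry.Manifold.InjOnLocalDiffeomorphInverse
import Literature.Geometry.Kaehler.ManifoldFormsPullback
import Literature.Geometry.Symplectic.OrigamiCutFormProduct
import HarnessLib

/-!
# Pushing a periodic model form forward along a tubular chart

Topic `Geometry/Symplectic`; namespace `Literature.Geometry.Symplectic`.  Theorems only; no named
fact, no `sorry`.  The manifold-level half of the gluing along an even zero circle (Perutz 2006,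
proof of Lemma 3.1, steps 2–3): let `χ : ℝ⁴ ⊇ hondaTube R → M` be a `2π`-periodic immersion,
smooth on the tube and injective modulo `2πℤ e₀`, let `sf` be a `2`-form on `M` and `G'` a
`C^∞`, closed, `2π`-periodic `Λ²`-valued map on the tube which agrees with `χ^*sf` on the shell
`R/2 < |x|`.  Then the form

`sf' x = (dχ_q⁻¹)^* G'(q)` for `x = χ q`, `q ∈ hondaTube R`;  `sf' x = sf x` otherwise

(independent of the choice of `q`, by periodicity) satisfies `χ^*sf' = G'` on the tube, agrees
with `sf` off the (closed) image of the core `|x| ≤ R/2`, and is smooth / closed when `sf` is: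
near an image point it is the pull-back of `G'` along the smooth local inverse of `χ`
(`contMDiffOn_invFunOn_of_bijective_mfderiv`).  Main statement: `exists_pushforwardForm`.

## References

* T. Perutz, *Zero-sets of near-symplectic forms*, J. Symplectic Geom. 4 (2006), §3, proof of
  Lemma 3.1. [Perutz2006]
* J. M. Lee, *Introduction to Smooth Manifolds*, 2nd ed. (2013), Thm. 4.5 (inverse function
  theorem). [LeeSmoothManifolds2013]
-/

noncomputable section

open scoped Manifold ContDiff Topology Real Classical
open Set Function Filter Module Real Literature.Topology.FourManifolds Literature.Geometry.Kaehler
  Literature.Geometry.Manifold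

namespace Literature.Geometry.Symplectic

universe u

/-! ### Integer translates along the axis -/

/-- Integer axis translates stay in the tube. [folklore] -/
theorem add_zsmul_mem_hondaTube {R : ℝ} {q : EuclideanSpace ℝ (Fin 4)} (hq : q ∈ hondaTube R)
    (k : ℤ) : q + (2 * π * k) • EuclideanSpace.single (0 : Fin 4) (1 : ℝ) ∈ hondaTube R :=
  (add_smul_single_mem_hondaTube_iff q _).2 hq

/-- A `2π`-periodic function is `2πℤ`-periodic. [folklore] -/
theorem apply_add_zsmul_of_periodic {α : Type*} {F : EuclideanSpace ℝ (Fin 4) → α}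
    (hper : ∀ q, F (q + (2 * π) • EuclideanSpace.single (0 : Fin 4) (1 : ℝ)) = F q)
    (q : EuclideanSpace ℝ (Fin 4)) (k : ℤ) :
    F (q + (2 * π * k) • EuclideanSpace.single (0 : Fin 4) (1 : ℝ)) = F q := by
  induction k using Int.induction_on generalizing q with
  | zero => simp
  | succ n ih =>
    have h1 : q + (2 * π * ((n : ℤ) + 1 : ℤ)) • EuclideanSpace.single (0 : Fin 4) (1 : ℝ) =
        (q + (2 * π * (n : ℤ)) • EuclideanSpace.single (0 : Fin 4) (1 : ℝ)) +
          (2 * π) • EuclideanSpace.single (0 : Fin 4) (1 : ℝ) := by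
      push_cast
      rw [add_assoc, ← add_smul]
      ring_nf
    rw [h1, hper, ih]
  | pred n ih =>
    have h1 := hper (q + (2 * π * (-(n : ℤ) - 1 : ℤ)) • EuclideanSpace.single (0 : Fin 4) (1 : ℝ))
    have h2 : q + (2 * π * (-(n : ℤ) - 1 : ℤ)) • EuclideanSpace.single (0 : Fin 4) (1 : ℝ) +
        (2 * π) • EuclideanSpace.single (0 : Fin 4) (1 : ℝ) =
        q + (2 * π * (-(n : ℤ) : ℤ)) • EuclideanSpace.single (0 : Fin 4) (1 : ℝ) := by
      push_cast
      rw [add_assoc, ← add_smul]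
      ring_nf
    rw [h2] at h1
    rw [← h1, ih]

variable {M : Type u} [TopologicalSpace M] [ChartedSpace (EuclideanSpace ℝ (Fin 4)) M]
  [IsManifold (𝓡 4) ∞ M]

omit [IsManifold (𝓡 4) ∞ M] in
/-- **The differential of a periodic chart is `2πℤ`-periodic on the tube.** [folklore] -/
theorem flatDifferential_add_zsmul {χ : EuclideanSpace ℝ (Fin 4) → M} {R : ℝ}
    (hper : ∀ q, χ (q + (2 * π) • EuclideanSpace.single 0 1) = χ q)
    (hχs : ContMDiffOn 𝓘(ℝ, EuclideanSpace ℝ (Fin 4)) (𝓡 4) ∞ χ (hondaTube R))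
    {q : EuclideanSpace ℝ (Fin 4)} (hq : q ∈ hondaTube R) (k : ℤ) :
    flatDifferential χ (q + (2 * π * k) • EuclideanSpace.single (0 : Fin 4) (1 : ℝ)) =
      flatDifferential χ q := by
  have hd : ∀ q ∈ hondaTube R,
      MDifferentiableAt 𝓘(ℝ, EuclideanSpace ℝ (Fin 4)) (𝓡 4) χ q := fun q hq ↦
    ((hχs q hq).contMDiffAt ((isOpen_hondaTube R).mem_nhds hq)).mdifferentiableAt (by simp)
  induction k using Int.induction_on generalizing q with
  | zero => simp
  | succ n ih =>
    have h1 : q + (2 * π * ((n : ℤ) + 1 : ℤ)) • EuclideanSpace.single (0 : Fin 4) (1 : ℝ) =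
        (q + (2 * π * (n : ℤ)) • EuclideanSpace.single (0 : Fin 4) (1 : ℝ)) +
          (2 * π) • EuclideanSpace.single (0 : Fin 4) (1 : ℝ) := by
      push_cast
      rw [add_assoc, ← add_smul]
      ring_nf
    rw [h1]
    have hq' := add_zsmul_mem_hondaTube hq (n : ℤ)
    have hq'' : q + (2 * π * (n : ℤ)) • EuclideanSpace.single (0 : Fin 4) (1 : ℝ) +
        (2 * π) • EuclideanSpace.single (0 : Fin 4) (1 : ℝ) ∈ hondaTube R :=
      (add_smul_single_mem_hondaTube_iff _ _).2 hq'
    have key := mfderiv_eq_mfderiv_add_of_forall hper (hd _ hq'')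
    rw [flatDifferential_eq, flatDifferential_eq, ← key, ← flatDifferential_eq,
      ← flatDifferential_eq, ih hq]
  | pred n ih =>
    have hq' := add_zsmul_mem_hondaTube hq (-(n : ℤ) - 1)
    have h2 : q + (2 * π * (-(n : ℤ) - 1 : ℤ)) • EuclideanSpace.single (0 : Fin 4) (1 : ℝ) +
        (2 * π) • EuclideanSpace.single (0 : Fin 4) (1 : ℝ) =
        q + (2 * π * (-(n : ℤ) : ℤ)) • EuclideanSpace.single (0 : Fin 4) (1 : ℝ) := by
      push_cast
      rw [add_assoc, ← add_smul]
      ring_nf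
    have hq'' : q + (2 * π * (-(n : ℤ) - 1 : ℤ)) • EuclideanSpace.single (0 : Fin 4) (1 : ℝ) +
        (2 * π) • EuclideanSpace.single (0 : Fin 4) (1 : ℝ) ∈ hondaTube R := by
      rw [h2]; exact add_zsmul_mem_hondaTube hq _
    have key := mfderiv_eq_mfderiv_add_of_forall hper (hd _ hq'')
    rw [h2] at key
    rw [flatDifferential_eq, flatDifferential_eq, key, ← flatDifferential_eq,
      ← flatDifferential_eq, ih hq]

omit [IsManifold (𝓡 4) ∞ M] in
/-- **The differential and its `ContinuousLinearMap.inverse`** at a point of the tube: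
`dχ⁻¹ ∘ dχ = id`. [folklore] -/
theorem flatDifferential_inverse_comp {χ : EuclideanSpace ℝ (Fin 4) → M}
    {q : EuclideanSpace ℝ (Fin 4)}
    (hinj : Injective (mfderiv 𝓘(ℝ, EuclideanSpace ℝ (Fin 4)) (𝓡 4) χ q)) :
    (flatDifferential χ q).inverse.comp (flatDifferential χ q) =
      ContinuousLinearMap.id ℝ (EuclideanSpace ℝ (Fin 4)) := by
  have hb := bijective_flatDifferential_of_injective hinj
  rw [← coe_continuousLinearEquivOfBijective (flatDifferential χ q) hb,
    ContinuousLinearMap.inverse_equiv, ContinuousLinearEquiv.coe_symm_comp_coe]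

omit [IsManifold (𝓡 4) ∞ M] in
/-- `dχ ∘ dχ⁻¹ = id`. [folklore] -/
theorem flatDifferential_comp_inverse {χ : EuclideanSpace ℝ (Fin 4) → M}
    {q : EuclideanSpace ℝ (Fin 4)}
    (hinj : Injective (mfderiv 𝓘(ℝ, EuclideanSpace ℝ (Fin 4)) (𝓡 4) χ q)) :
    (flatDifferential χ q).comp (flatDifferential χ q).inverse =
      ContinuousLinearMap.id ℝ (EuclideanSpace ℝ (Fin 4)) := by
  have hb := bijective_flatDifferential_of_injective hinj
  rw [← coe_continuousLinearEquivOfBijective (flatDifferential χ q) hb,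
    ContinuousLinearMap.inverse_equiv, ContinuousLinearEquiv.coe_comp_coe_symm]

/-! ### The push-forward form: pointwise identities -/

section Pointwise

variable {sf sf' : MForm (𝓡 4) M ℝ 2} {χ : EuclideanSpace ℝ (Fin 4) → M} {R : ℝ}
  {G' : EuclideanSpace ℝ (Fin 4) → (EuclideanSpace ℝ (Fin 4)) [⋀^Fin 2]→L[ℝ] ℝ}
  (hsf' : ∀ x, sf' x = if h : ∃ q ∈ hondaTube R, χ q = x then
    (G' h.choose).compContinuousLinearMap (flatDifferential χ h.choose).inverse else sf x)
  (hper : ∀ q, χ (q + (2 * π) • EuclideanSpace.single 0 1) = χ q)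
  (hχs : ContMDiffOn 𝓘(ℝ, EuclideanSpace ℝ (Fin 4)) (𝓡 4) ∞ χ (hondaTube R))
  (hχinj : ∀ q ∈ hondaTube R, ∀ q' ∈ hondaTube R, χ q' = χ q →
    ∃ k : ℤ, q' = q + (2 * π * k) • EuclideanSpace.single 0 1)
  (hχimm : ∀ q ∈ hondaTube R, Injective (mfderiv 𝓘(ℝ, EuclideanSpace ℝ (Fin 4)) (𝓡 4) χ q))
  (hG'per : ∀ q, G' (q + (2 * π) • EuclideanSpace.single (0 : Fin 4) (1 : ℝ)) = G' q)

omit [IsManifold (𝓡 4) ∞ M] in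
include hsf' hper hχs hχinj hG'per in
/-- **Value of the push-forward at an image point**: `sf'(χ q) = (dχ_q⁻¹)^* G'(q)` for EVERY
`q` of the tube (independence of the lift, by periodicity). [cite: Perutz2006, §3 (proof of Lemma 3.1)] -/
theorem pushforward_apply_chart {q : EuclideanSpace ℝ (Fin 4)} (hq : q ∈ hondaTube R) :
    sf' (χ q) = (G' q).compContinuousLinearMap (flatDifferential χ q).inverse := by
  have h : ∃ q' ∈ hondaTube R, χ q' = χ q := ⟨q, hq, rfl⟩
  rw [hsf', dif_pos h]
  obtain ⟨k, hk⟩ := hχinj q hq h.choose h.choose_spec.1 h.choose_spec.2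
  rw [hk, apply_add_zsmul_of_periodic hG'per, flatDifferential_add_zsmul hper hχs hq]

omit [IsManifold (𝓡 4) ∞ M] in
include hsf' hper hχs hχinj hχimm hG'per in
/-- **`χ^* sf' = G'` on the tube.** [cite: Perutz2006, §3 (proof of Lemma 3.1)] -/
theorem pullback_pushforward {q : EuclideanSpace ℝ (Fin 4)} (hq : q ∈ hondaTube R) :
    sf'.pullback 𝓘(ℝ, EuclideanSpace ℝ (Fin 4)) χ q = G' q := by
  have key : sf'.pullback 𝓘(ℝ, EuclideanSpace ℝ (Fin 4)) χ q =
      (sf' (χ q)).compContinuousLinearMap (flatDifferential χ q) := rfl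
  rw [key, pushforward_apply_chart hsf' hper hχs hχinj hG'per hq]
  ext v
  show G' q ((flatDifferential χ q).inverse ∘ ((flatDifferential χ q) ∘ v)) = G' q v
  congr 1
  funext i
  have h := congrArg (fun L : EuclideanSpace ℝ (Fin 4) →L[ℝ] EuclideanSpace ℝ (Fin 4) ↦ L (v i))
    (flatDifferential_inverse_comp (hχimm q hq))
  show (flatDifferential χ q).inverse ((flatDifferential χ q) (v i)) = v i
  simpa using h

omit [IsManifold (𝓡 4) ∞ M] in
include hsf' in
/-- Off the image of the tube `sf' = sf`. [folklore] -/
theorem pushforward_eq_of_not_mem_image {x : M} (hx : x ∉ χ '' hondaTube R) : sf' x = sf x := by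
  have h : ¬ ∃ q ∈ hondaTube R, χ q = x := fun ⟨q, hq, hqx⟩ ↦ hx ⟨q, hq, hqx⟩
  rw [hsf', dif_neg h]

omit [IsManifold (𝓡 4) ∞ M] in
include hsf' hper hχs hχinj hχimm hG'per in
/-- **Off the image of the core `|x| ≤ R/2`, `sf' = sf`**, provided `G' = χ^*sf` on the shell
`R/2 < |x|`. [cite: Perutz2006, §3 (proof of Lemma 3.1)] -/
theorem pushforward_eq_of_not_mem_core
    (hG'eq : ∀ q ∈ hondaTube R, R / 2 < ‖q - hondaAxisPoint (q 0)‖ →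
      G' q = sf.pullback 𝓘(ℝ, EuclideanSpace ℝ (Fin 4)) χ q) {x : M}
    (hx : x ∉ χ '' {q | q ∈ hondaTube R ∧ ‖q - hondaAxisPoint (q 0)‖ ≤ R / 2}) :
    sf' x = sf x := by
  by_cases h : ∃ q ∈ hondaTube R, χ q = x
  · obtain ⟨q, hq, rfl⟩ := h
    have hfar : R / 2 < ‖q - hondaAxisPoint (q 0)‖ :=
      not_le.1 fun hle ↦ hx ⟨q, ⟨hq, hle⟩, rfl⟩
    rw [pushforward_apply_chart hsf' hper hχs hχinj hG'per hq, hG'eq q hq hfar]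
    have key : sf.pullback 𝓘(ℝ, EuclideanSpace ℝ (Fin 4)) χ q =
        (sf (χ q)).compContinuousLinearMap (flatDifferential χ q) := rfl
    rw [key]
    ext v
    show sf (χ q) ((flatDifferential χ q) ∘ ((flatDifferential χ q).inverse ∘ v)) = sf (χ q) v
    congr 1
    funext i
    have h := congrArg (fun L : EuclideanSpace ℝ (Fin 4) →L[ℝ] EuclideanSpace ℝ (Fin 4) ↦ L (v i))
      (flatDifferential_comp_inverse (hχimm q hq))
    show (flatDifferential χ q) ((flatDifferential χ q).inverse (v i)) = v i
    simpa using h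
  · rw [hsf', dif_neg h]

end Pointwise

/-! ### The image of the core is closed -/

/-- Points at distance `< R` from the axis lie in the tube of radius `R > 0`. [folklore] -/
theorem mem_hondaTube_of_norm_sub_lt {R : ℝ} {q : EuclideanSpace ℝ (Fin 4)}
    (h : ‖q - hondaAxisPoint (q 0)‖ < R) : q ∈ hondaTube R := by
  rw [mem_hondaTube, ← norm_sub_hondaAxisPoint_sq]
  exact pow_lt_pow_left₀ h (norm_nonneg _) two_ne_zero

/-- The core piece `{|x| ≤ R/2, q₀ ∈ [0, 2π]}` is compact. [folklore] -/
theorem isCompact_corePiece (R : ℝ) :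
    IsCompact {q : EuclideanSpace ℝ (Fin 4) |
      ‖q - hondaAxisPoint (q 0)‖ ≤ R / 2 ∧ q 0 ∈ Icc (0 : ℝ) (2 * π)} := by
  obtain ⟨L, hL⟩ := exists_normalProjCLM
  have hcont : Continuous fun q : EuclideanSpace ℝ (Fin 4) ↦ ‖q - hondaAxisPoint (q 0)‖ := by
    have : (fun q : EuclideanSpace ℝ (Fin 4) ↦ ‖q - hondaAxisPoint (q 0)‖) = fun q ↦ ‖L q‖ :=
      funext fun q ↦ by rw [hL]
    rw [this]; exact continuous_norm.comp L.continuous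
  have h0 : Continuous fun q : EuclideanSpace ℝ (Fin 4) ↦ q 0 :=
    (EuclideanSpace.proj (0 : Fin 4) : EuclideanSpace ℝ (Fin 4) →L[ℝ] ℝ).continuous
  have hclosed : IsClosed {q : EuclideanSpace ℝ (Fin 4) |
      ‖q - hondaAxisPoint (q 0)‖ ≤ R / 2 ∧ q 0 ∈ Icc (0 : ℝ) (2 * π)} :=
    (isClosed_le hcont continuous_const).inter (isClosed_Icc.preimage h0)
  refine Metric.isCompact_of_isClosed_isBounded hclosed ?_
  refine (Metric.isBounded_iff_subset_closedBall 0).2 ⟨|R / 2| + 2 * π, fun q hq ↦ ?_⟩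
  rw [Metric.mem_closedBall, dist_zero_right]
  have h1 : ‖q‖ ≤ ‖q - hondaAxisPoint (q 0)‖ + ‖hondaAxisPoint (q 0)‖ := by
    have := norm_add_le (q - hondaAxisPoint (q 0)) (hondaAxisPoint (q 0))
    rwa [sub_add_cancel] at this
  have h2 : ‖hondaAxisPoint (q 0)‖ = |q 0| := by
    rw [hondaAxisPoint_eq_single]
    simp
  have h3 : |q 0| ≤ 2 * π := abs_le.2 ⟨by linarith [hq.2.1, Real.pi_pos], hq.2.2⟩
  linarith [hq.1, le_abs_self (R / 2)]

omit [IsManifold (𝓡 4) ∞ M] in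
/-- **The image of the core under a periodic chart is closed** (it is the continuous image of the
compact core piece). [folklore] -/
theorem isClosed_image_core [T2Space M] {χ : EuclideanSpace ℝ (Fin 4) → M} {R : ℝ} (hR : 0 < R)
    (hper : ∀ q, χ (q + (2 * π) • EuclideanSpace.single 0 1) = χ q)
    (hχs : ContMDiffOn 𝓘(ℝ, EuclideanSpace ℝ (Fin 4)) (𝓡 4) ∞ χ (hondaTube R)) :
    IsClosed (χ '' {q | q ∈ hondaTube R ∧ ‖q - hondaAxisPoint (q 0)‖ ≤ R / 2}) := by
  set K := {q : EuclideanSpace ℝ (Fin 4) |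
    ‖q - hondaAxisPoint (q 0)‖ ≤ R / 2 ∧ q 0 ∈ Icc (0 : ℝ) (2 * π)} with hK
  have hKsub : K ⊆ hondaTube R := fun q hq ↦
    mem_hondaTube_of_norm_sub_lt (lt_of_le_of_lt hq.1 (by linarith))
  have himg : χ '' {q | q ∈ hondaTube R ∧ ‖q - hondaAxisPoint (q 0)‖ ≤ R / 2} = χ '' K := by
    apply Subset.antisymm
    · rintro _ ⟨q, ⟨hq, hqc⟩, rfl⟩
      -- reduce the angle to `[0, 2π)`
      set k : ℤ := toIcoDiv two_pi_pos 0 (q 0) with hk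
      refine ⟨q + (2 * π * ((-k : ℤ) : ℝ)) • EuclideanSpace.single (0 : Fin 4) (1 : ℝ), ⟨?_, ?_⟩, ?_⟩
      · rw [sub_hondaAxisPoint_add_smul]; exact hqc
      · have h := sub_toIcoDiv_zsmul_mem_Ico two_pi_pos 0 (q 0)
        rw [zero_add] at h
        have h0 : (q + (2 * π * ((-k : ℤ) : ℝ)) • EuclideanSpace.single (0 : Fin 4) (1 : ℝ)) 0 =
            q 0 - k • (2 * π) := by
          push_cast; simp [zsmul_eq_mul]; ring
        rw [h0]
        exact ⟨h.1, h.2.le⟩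
      · exact apply_add_zsmul_of_periodic (F := χ) hper q (-k)
    · rintro _ ⟨q, hq, rfl⟩
      exact ⟨q, ⟨hKsub hq, hq.1⟩, rfl⟩
  rw [himg]
  exact ((isCompact_corePiece R).image_of_continuousOn (hχs.continuousOn.mono hKsub)).isClosed

/-! ### Local representation as a pull-back along the local inverse -/

section Local

variable {sf sf' : MForm (𝓡 4) M ℝ 2} {χ : EuclideanSpace ℝ (Fin 4) → M} {R : ℝ}
  {G' : EuclideanSpace ℝ (Fin 4) → (EuclideanSpace ℝ (Fin 4)) [⋀^Fin 2]→L[ℝ] ℝ}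
  (hsf' : ∀ x, sf' x = if h : ∃ q ∈ hondaTube R, χ q = x then
    (G' h.choose).compContinuousLinearMap (flatDifferential χ h.choose).inverse else sf x)
  (hper : ∀ q, χ (q + (2 * π) • EuclideanSpace.single 0 1) = χ q)
  (hχs : ContMDiffOn 𝓘(ℝ, EuclideanSpace ℝ (Fin 4)) (𝓡 4) ∞ χ (hondaTube R))
  (hχinj : ∀ q ∈ hondaTube R, ∀ q' ∈ hondaTube R, χ q' = χ q →
    ∃ k : ℤ, q' = q + (2 * π * k) • EuclideanSpace.single 0 1)
  (hχimm : ∀ q ∈ hondaTube R, Injective (mfderiv 𝓘(ℝ, EuclideanSpace ℝ (Fin 4)) (𝓡 4) χ q))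
  (hG'per : ∀ q, G' (q + (2 * π) • EuclideanSpace.single (0 : Fin 4) (1 : ℝ)) = G' q)

include hsf' hper hχs hχinj hχimm hG'per in
/-- **Near an image point `sf'` is the pull-back of `G'` along the smooth local inverse of
`χ`.** [cite: Perutz2006, §3 (proof of Lemma 3.1); LeeSmoothManifolds2013, Thm. 4.5] -/
theorem pushforward_eventuallyEq_pullback {q₀ : EuclideanSpace ℝ (Fin 4)} (hq₀ : q₀ ∈ hondaTube R) :
    ∃ ψ : M → EuclideanSpace ℝ (Fin 4),
      (∀ᶠ x in 𝓝 (χ q₀), ContMDiffAt (𝓡 4) 𝓘(ℝ, EuclideanSpace ℝ (Fin 4)) ∞ ψ x) ∧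
      ψ (χ q₀) = q₀ ∧ (∀ᶠ x in 𝓝 (χ q₀), ψ x ∈ hondaTube R) ∧
      ∀ᶠ x in 𝓝 (χ q₀), sf' x =
        MForm.pullback (I' := 𝓘(ℝ, EuclideanSpace ℝ (Fin 4))) (𝓡 4) ψ G' x := by
  haveI : Nonempty M := ⟨χ q₀⟩
  set s : Set (EuclideanSpace ℝ (Fin 4)) := hondaTube R ∩ {q | |q 0 - q₀ 0| < π} with hs
  have hso : IsOpen s := by
    have h0 : Continuous fun q : EuclideanSpace ℝ (Fin 4) ↦ |q 0 - q₀ 0| :=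
      ((EuclideanSpace.proj (0 : Fin 4) : EuclideanSpace ℝ (Fin 4) →L[ℝ] ℝ).continuous.sub
        continuous_const).abs
    exact (isOpen_hondaTube R).inter (isOpen_lt h0 continuous_const)
  have hq₀s : q₀ ∈ s := ⟨hq₀, by simp [Real.pi_pos]⟩
  have hsub : s ⊆ hondaTube R := inter_subset_left
  have hχs' : ContMDiffOn 𝓘(ℝ, EuclideanSpace ℝ (Fin 4)) (𝓡 4) ∞ χ s := hχs.mono hsub
  have hinjOn : InjOn χ s := injOn_of_eq_add_of_eq hχinj (q₀ 0)
  have hbij : ∀ q ∈ s, Bijective (mfderiv 𝓘(ℝ, EuclideanSpace ℝ (Fin 4)) (𝓡 4) χ q) :=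
    fun q hq ↦ bijective_flatDifferential_of_injective (hχimm q (hsub hq))
  have hVo : IsOpen (χ '' s) := isOpen_image_of_bijective_mfderiv hso hχs' hbij
  have hVx : χ '' s ∈ 𝓝 (χ q₀) := hVo.mem_nhds ⟨q₀, hq₀s, rfl⟩
  set ψ : M → EuclideanSpace ℝ (Fin 4) := invFunOn χ s with hψ
  have hψs : ContMDiffOn (𝓡 4) 𝓘(ℝ, EuclideanSpace ℝ (Fin 4)) ∞ ψ (χ '' s) :=
    contMDiffOn_invFunOn_of_bijective_mfderiv hso hχs' hinjOn hbij
  refine ⟨ψ, ?_, invFunOn_apply hinjOn hq₀s, ?_, ?_⟩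
  · filter_upwards [hVx] with x hx
    exact hψs.contMDiffAt (hVo.mem_nhds hx)
  · filter_upwards [hVx] with x hx
    exact hsub (Function.invFunOn_mem hx)
  · filter_upwards [hVx] with x hx
    obtain ⟨q, hq, rfl⟩ := hx
    have hψq : ψ (χ q) = q := invFunOn_apply hinjOn hq
    -- the value of `dψ` at `χ q` is `dχ_q⁻¹`
    have hB : ∀ u : EuclideanSpace ℝ (Fin 4),
        (mfderiv (𝓡 4) 𝓘(ℝ, EuclideanSpace ℝ (Fin 4)) ψ (χ q) u : EuclideanSpace ℝ (Fin 4)) =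
          (flatDifferential χ q).inverse u := by
      intro u
      have h1 := mfderiv_comp_mfderiv_invFunOn hso hχs' hinjOn hbij hq u
      have h2 := congrArg (fun L : EuclideanSpace ℝ (Fin 4) →L[ℝ] EuclideanSpace ℝ (Fin 4) ↦
        L (mfderiv (𝓡 4) 𝓘(ℝ, EuclideanSpace ℝ (Fin 4)) ψ (χ q) u))
        (flatDifferential_inverse_comp (hχimm q (hsub hq)))
      simp only [ContinuousLinearMap.comp_apply, ContinuousLinearMap.id_apply,
        flatDifferential_apply] at h2
      rw [← h2]
      exact congrArg ((flatDifferential χ q).inverse) h1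
    rw [pushforward_apply_chart hsf' hper hχs hχinj hG'per (hsub hq)]
    ext v
    change (G' q) (⇑(flatDifferential χ q).inverse ∘ v) =
      G' (ψ (χ q)) (fun i ↦ mfderiv (𝓡 4) 𝓘(ℝ, EuclideanSpace ℝ (Fin 4)) ψ (χ q) (v i))
    rw [show G' (ψ (χ q)) = G' q by rw [hψq]]
    congr 1
    funext i
    exact (hB (v i)).symm

include hsf' hper hχs hχinj hχimm hG'per in
/-- **Smoothness of `sf'` at image points.** [cite: Perutz2006, §3 (proof of Lemma 3.1)] -/
theorem smoothAt_pushforward_image (hG's : ContDiffOn ℝ ∞ G' (hondaTube R))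
    {q₀ : EuclideanSpace ℝ (Fin 4)} (hq₀ : q₀ ∈ hondaTube R) : sf'.SmoothAt (χ q₀) := by
  obtain ⟨ψ, hψs, hψ0, -, hev⟩ := pushforward_eventuallyEq_pullback hsf' hper hχs hχinj hχimm
    hG'per hq₀
  refine (MForm.smoothAt_congr_of_eventuallyEq hev).2 (MForm.SmoothAt.pullback hψs ?_)
  rw [hψ0]
  show ContDiffWithinAt ℝ ∞ (MForm.inChart (I := 𝓘(ℝ, EuclideanSpace ℝ (Fin 4))) G' q₀)
    (range 𝓘(ℝ, EuclideanSpace ℝ (Fin 4))) (extChartAt 𝓘(ℝ, EuclideanSpace ℝ (Fin 4)) q₀ q₀)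
  rw [inChart_eq_self_model]
  simp only [extChartAt_self_apply, modelWithCornersSelf_coe, range_id]
  exact (hG's.contDiffAt ((isOpen_hondaTube R).mem_nhds hq₀)).contDiffWithinAt

include hsf' hper hχs hχinj hχimm hG'per in
/-- **`d sf' = 0` at image points** (naturality of `d` and closedness of `G'`).
[cite: Perutz2006, §3 (proof of Lemma 3.1)] -/
theorem mextDeriv_pushforward_image (hG's : ContDiffOn ℝ ∞ G' (hondaTube R))
    (hG'cl : ∀ q ∈ hondaTube R, extDeriv G' q = 0)
    {q₀ : EuclideanSpace ℝ (Fin 4)} (hq₀ : q₀ ∈ hondaTube R) : mextDeriv sf' (χ q₀) = 0 := by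
  obtain ⟨ψ, hψs, hψ0, -, hev⟩ := pushforward_eventuallyEq_pullback hsf' hper hχs hχinj hχimm
    hG'per hq₀
  have hβ : MForm.SmoothAt (I := 𝓘(ℝ, EuclideanSpace ℝ (Fin 4))) G' (ψ (χ q₀)) := by
    rw [hψ0]
    show ContDiffWithinAt ℝ ∞ (MForm.inChart (I := 𝓘(ℝ, EuclideanSpace ℝ (Fin 4))) G' q₀)
      (range 𝓘(ℝ, EuclideanSpace ℝ (Fin 4))) (extChartAt 𝓘(ℝ, EuclideanSpace ℝ (Fin 4)) q₀ q₀)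
    rw [inChart_eq_self_model]
    simp only [extChartAt_self_apply, modelWithCornersSelf_coe, range_id]
    exact (hG's.contDiffAt ((isOpen_hondaTube R).mem_nhds hq₀)).contDiffWithinAt
  rw [mextDeriv_congr_of_eventuallyEq hev, mextDeriv_pullback_apply hψs hβ]
  have h0 : mextDeriv (I := 𝓘(ℝ, EuclideanSpace ℝ (Fin 4))) G' (ψ (χ q₀)) = 0 := by
    rw [mextDeriv_eq_extDeriv, hψ0]
    exact hG'cl q₀ hq₀
  ext v
  rw [MForm.pullback_apply, h0]
  rfl

end Local

/-! ### The push-forward form -/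

/-- **Pushing a periodic model form forward along a tubular chart** (Perutz 2006, proof of
Lemma 3.1): see the module docstring.  The form `sf'` with `χ^*sf' = G'` on `hondaTube R`,
`sf' = sf` off the closed image of the core (in particular off the image of the tube), smooth if
`sf` is smooth and closed if `sf` is closed. [cite: Perutz2006, Lemma 3.1 (proof)] -/
theorem exists_pushforwardForm [T2Space M] {sf : MForm (𝓡 4) M ℝ 2}
    {χ : EuclideanSpace ℝ (Fin 4) → M} {R : ℝ} (hR : 0 < R)
    (hper : ∀ q, χ (q + (2 * π) • EuclideanSpace.single 0 1) = χ q)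
    (hχs : ContMDiffOn 𝓘(ℝ, EuclideanSpace ℝ (Fin 4)) (𝓡 4) ∞ χ (hondaTube R))
    (hχinj : ∀ q ∈ hondaTube R, ∀ q' ∈ hondaTube R, χ q' = χ q →
      ∃ k : ℤ, q' = q + (2 * π * k) • EuclideanSpace.single 0 1)
    (hχimm : ∀ q ∈ hondaTube R, Injective (mfderiv 𝓘(ℝ, EuclideanSpace ℝ (Fin 4)) (𝓡 4) χ q))
    {G' : EuclideanSpace ℝ (Fin 4) → (EuclideanSpace ℝ (Fin 4)) [⋀^Fin 2]→L[ℝ] ℝ}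
    (hG's : ContDiffOn ℝ ∞ G' (hondaTube R))
    (hG'per : ∀ q, G' (q + (2 * π) • EuclideanSpace.single (0 : Fin 4) (1 : ℝ)) = G' q)
    (hG'cl : ∀ q ∈ hondaTube R, extDeriv G' q = 0)
    (hG'eq : ∀ q ∈ hondaTube R, R / 2 < ‖q - hondaAxisPoint (q 0)‖ →
      G' q = sf.pullback 𝓘(ℝ, EuclideanSpace ℝ (Fin 4)) χ q) :
    ∃ sf' : MForm (𝓡 4) M ℝ 2,
      (∀ q ∈ hondaTube R, sf'.pullback 𝓘(ℝ, EuclideanSpace ℝ (Fin 4)) χ q = G' q) ∧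
      (∀ x, x ∉ χ '' {q | q ∈ hondaTube R ∧ ‖q - hondaAxisPoint (q 0)‖ ≤ R / 2} → sf' x = sf x) ∧
      IsClosed (χ '' {q | q ∈ hondaTube R ∧ ‖q - hondaAxisPoint (q 0)‖ ≤ R / 2}) ∧
      χ '' {q | q ∈ hondaTube R ∧ ‖q - hondaAxisPoint (q 0)‖ ≤ R / 2} ⊆ χ '' hondaTube R ∧
      (IsSmoothForm sf → IsSmoothForm sf') ∧ (IsClosedForm sf → IsClosedForm sf') := by
  classical
  set sf' : MForm (𝓡 4) M ℝ 2 := fun x ↦ if h : ∃ q ∈ hondaTube R, χ q = x then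
    (G' h.choose).compContinuousLinearMap (flatDifferential χ h.choose).inverse else sf x with hdef
  have hsf' : ∀ x, sf' x = if h : ∃ q ∈ hondaTube R, χ q = x then
      (G' h.choose).compContinuousLinearMap (flatDifferential χ h.choose).inverse else sf x :=
    fun x ↦ rfl
  have hclosed := isClosed_image_core hR hper hχs
  have hcore : ∀ x, x ∉ χ '' {q | q ∈ hondaTube R ∧ ‖q - hondaAxisPoint (q 0)‖ ≤ R / 2} →
      sf' x = sf x := fun x hx ↦
    pushforward_eq_of_not_mem_core hsf' hper hχs hχinj hχimm hG'per hG'eq hx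
  have hsubimg : χ '' {q | q ∈ hondaTube R ∧ ‖q - hondaAxisPoint (q 0)‖ ≤ R / 2} ⊆
      χ '' hondaTube R := image_mono fun q hq ↦ hq.1
  -- off the image of the tube, `sf' = sf` near the point
  have hoff : ∀ x, x ∉ χ '' hondaTube R → ∀ᶠ w in 𝓝 x, sf' w = sf w := by
    intro x hx
    have hx' : x ∉ χ '' {q | q ∈ hondaTube R ∧ ‖q - hondaAxisPoint (q 0)‖ ≤ R / 2} :=
      fun h ↦ hx (hsubimg h)
    filter_upwards [hclosed.isOpen_compl.mem_nhds hx'] with w hw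
    exact hcore w hw
  refine ⟨sf', fun q hq ↦ pullback_pushforward hsf' hper hχs hχinj hχimm hG'per hq, hcore,
    hclosed, hsubimg, fun hsm ↦ ?_, fun hcl ↦ ?_⟩
  · intro x
    by_cases hx : x ∈ χ '' hondaTube R
    · obtain ⟨q, hq, rfl⟩ := hx
      exact smoothAt_pushforward_image hsf' hper hχs hχinj hχimm hG'per hG's hq
    · exact (MForm.smoothAt_congr_of_eventuallyEq (hoff x hx)).2 (hsm x)
  · funext x
    by_cases hx : x ∈ χ '' hondaTube R
    · obtain ⟨q, hq, rfl⟩ := hx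
      rw [mextDeriv_pushforward_image hsf' hper hχs hχinj hχimm hG'per hG's hG'cl hq]
      rfl
    · rw [mextDeriv_congr_of_eventuallyEq (hoff x hx)]
      have := congrFun hcl x
      exact this

end Literature.Geometry.Symplectic

end
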